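import Literature.Barriers.QuantumAdvantage.AaronsonChenProtocol
import HarnessLib

/-!
# Aaronson–Chen 2017, Lemma 5.3: the advice bit decomposed into two physical predicates

Support file for `aaronsonChen2017_lem53` (`AaronsonChenOracle.lean`): the machine half of
Aaronson–Chen 2017, Lemma 5.3 [AaronsonChen2017, §5.3 pp. 22–23] is reduced
(`AaronsonChenMachine.lean`: `aaronsonChen2017_lem53_of_advice`) to "`TQBF` is `PSPACE`-hard" and "the
advice language `AcProto.advLang` of the simulator's protocol is in `PSPACE`" (the printed "all the
computations can be done in `PSPACE`"). This file rewrites the advice bit as a Boolean combination of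
counting and minimisation conditions over TWO predicates on the simulator's replaced run — the
interface to the polynomial-space evaluation of Clifford+T circuits with `TQBF ⊕ table` query gates
(`QuantumComplexity/OraclePathSums.lean` and its sequels):

* `HeavyLang` — on `⟨⟨x₀, r⟩, ⟨h, ⟨ν, u⟩⟩⟩`: `u` is queried at stage `|ν|` (a heavy tail `Q(1u) ≥ 1/a`
  of the state before gate `|ν|` of the run with the tables read off `h`, or a small-table entry);
  `CdfLang` — on `⟨⟨x₀, r⟩, ⟨h, Y⟩⟩`: `|Y| =` number of wires and `r/2^{|r|} < F(⟦Y⟧)`, `F` the cumulative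
  distribution of the Born law of the final state in numeral order (`Sel`); membership lemmas;
* the learning phase: `block_getD_eq_true_iff`, `cntLess`, **`stageList_getElem?_eq_some_iff`** (the
  `s`-th queried string is the queried string with exactly `s` smaller queried strings — stage lists are
  strictly increasing, `pairwise_stageList`, `getElem?_eq_some_iff_of_pairwise`), the counting
  relation `LessRel` and **`countWitnesses_LessRel`** (its witness count is `cntLess`);
* the sampling phase: `IsSample` (selected, and no smaller label selected), `invCdf_isLeast`,
  `ofFn_qregEquiv_symm`, **`ofFn_ySample_eq_iff`** (`ofFn (ySample) = Y ↔ IsSample Y`);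
* **`advBit_eq_true_iff`** — the advice bit is set iff `|h|` is even and, by the phase of `j = |h|/2`,
  the corresponding condition holds.

Sequel: `AaronsonChenAdviceMaps.lean`, `AaronsonChenAdviceLearn.lean`, `AaronsonChenAdvicePSPACE.lean`
turn this into `advLang ∈ PSPACE` given `HeavyLang, CdfLang ∈ PSPACE`.

## References

* [AaronsonChen2017] arXiv:1612.05903, §5.3 (pp. 22–23), read via `lit read arxiv:1612.05903 --pages 19-25`.
* [KnuthTAOCP2] §3.4.1 A (the inversion method), as in `InverseCdfSampling.lean`.
-/

noncomputable section

namespace Literature.Barriers.QuantumAdvantage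

open MeasureTheory _root_.Computability Polynomial Literature.Computability.Complexity
  Literature.Computability.Cryptography
open Literature.Computability.QuantumComplexity hiding natBits length_natBits

/-! ### Sorted lists: position `s` = exactly `s` smaller elements -/

/-- In a list strictly increasing for a key `f`, the entry at position `s` is the member with exactly
`s` members of smaller key. [folklore] -/
theorem getElem?_eq_some_iff_of_pairwise {α : Type*} {f : α → ℕ} :
    ∀ {l : List α}, l.Pairwise (fun a b => f a < f b) → ∀ (s : ℕ) (u : α),
      l[s]? = some u ↔ u ∈ l ∧ (l.filter fun a => decide (f a < f u)).length = s
  | [], _, s, u => by simp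
  | a :: l, hl, s, u => by
    rw [List.pairwise_cons] at hl
    obtain ⟨ha, hl⟩ := hl
    cases s with
    | zero =>
      simp only [List.getElem?_cons_zero, Option.some.injEq, List.mem_cons, List.filter_cons,
        List.length_eq_zero_iff]
      constructor
      · rintro rfl
        refine ⟨Or.inl rfl, ?_⟩
        rw [if_neg (by simp)]
        simp only [List.filter_eq_nil_iff, decide_eq_true_eq, not_lt]
        exact fun b hb => (ha b hb).le
      · rintro ⟨h | h, hlen⟩
        · exact h.symm
        · have := ha u h
          rw [if_pos (by simpa using this)] at hlen
          exact absurd hlen (by simp)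
    | succ s =>
      simp only [List.getElem?_cons_succ, List.mem_cons, List.filter_cons]
      rw [getElem?_eq_some_iff_of_pairwise hl s u]
      constructor
      · rintro ⟨hu, hlen⟩
        have := ha u hu
        rw [if_pos (by simpa using this)]
        exact ⟨Or.inr hu, by simp [hlen]⟩
      · rintro ⟨h | h, hlen⟩
        · subst h
          rw [if_neg (by simp)] at hlen
          have : (l.filter fun b => decide (f b < f u)) = [] := by
            simp only [List.filter_eq_nil_iff, decide_eq_true_eq, not_lt]
            exact fun b hb => (ha b hb).le
          rw [this] at hlen
          exact absurd hlen (by simp)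
        · have := ha u h
          rw [if_pos (by simpa using this)] at hlen
          exact ⟨h, by simpa using hlen⟩

/-- `allStr L` is strictly increasing in numeral value. [folklore] -/
theorem pairwise_allStr (L : ℕ) : (allStr L).Pairwise fun a b => bitsToNat a < bitsToNat b := by
  rw [allStr_eq_map_natBits, List.pairwise_map]
  refine List.Pairwise.imp_of_mem ?_ (List.pairwise_lt_range)
  intro i j hi hj hij
  rw [List.mem_range] at hi hj
  rwa [bitsToNat_natBits hi, bitsToNat_natBits hj]

namespace AcSim

variable {G : QGateSet} {N : ℕ}

/-- The list of strings queried at a gate is strictly increasing in numeral value. [folklore] -/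
theorem pairwise_stageListOf (a b : ℕ) (g : QGate G N) (v : QReg N → ℂ) :
    (stageListOf a b g v).Pairwise fun u u' => bitsToNat u < bitsToNat u' := by
  cases g with
  | gate g e => simp [stageListOf]
  | oracle k e =>
    cases k with
    | zero => simp [stageListOf]
    | succ k =>
      simp only [stageListOf]
      split_ifs
      · exact pairwise_allStr k
      · exact (pairwise_allStr _).filter _

/-- All strings queried at a gate have the same length. [folklore] -/
theorem length_eq_of_mem_stageListOf {a b : ℕ} {g : QGate G N} {v : QReg N → ℂ} {u u' : List Bool}
    (hu : u ∈ stageListOf a b g v) (hu' : u' ∈ stageListOf a b g v) : u.length = u'.length := by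
  cases g with
  | gate g e => simp [stageListOf] at hu
  | oracle k e =>
    cases k with
    | zero => simp [stageListOf] at hu
    | succ k =>
      simp only [stageListOf] at hu hu'
      split_ifs at hu hu'
      · rw [mem_allStr_iff] at hu hu'; omega
      · rw [mem_heavyList_iff, Nat.add_sub_cancel] at hu hu'; omega

end AcSim

namespace AcProto

variable (P : AcProto)

/-- The stage lists are strictly increasing in numeral value. [folklore] -/
theorem pairwise_stageList (x₀ : List Bool) (tabs : ℕ → Set (List Bool)) (n : ℕ) :
    (P.stageList x₀ tabs n).Pairwise fun u u' => bitsToNat u < bitsToNat u' := by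
  unfold stageList
  cases (P.gates x₀)[n]? with
  | none => simp
  | some g => exact AcSim.pairwise_stageListOf _ _ g _

/-- All strings of a stage list have the same length. [folklore] -/
theorem length_eq_of_mem_stageList {x₀ : List Bool} {tabs : ℕ → Set (List Bool)} {n : ℕ} {u u' : List Bool}
    (hu : u ∈ P.stageList x₀ tabs n) (hu' : u' ∈ P.stageList x₀ tabs n) : u.length = u'.length := by
  unfold stageList at hu hu'
  cases hg : (P.gates x₀)[n]? with
  | none => simp [hg] at hu
  | some g =>
    simp only [hg] at hu hu'
    exact AcSim.length_eq_of_mem_stageListOf hu hu'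

/-! ### The two physical predicates -/

/-- **The heavy/small-table predicate** on instances `⟨w, ⟨h, ⟨ν, u⟩⟩⟩`, `w = ⟨x₀, r⟩`: the string
`u` is queried at stage `|ν|` of the simulator's protocol — it is a heavy tail `Q(1u) ≥ 1/a` of the
state before gate `|ν|` of the run whose earlier query gates answer `TQBF ⊕ (table read off h)`,
or an entry of a small table there ("we query all `x` with `Q(x) ≥ τ`"; "we can simply query all the
positions"). Its membership in `PSPACE` is the first of the two computations the printed proof
delegates to the `TQBF` oracle. [cite: AaronsonChen2017, §5.3 (p. 22, "Construction and Analysis of g")] -/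
def HeavyLang : Language Bool :=
  {z | (boolUnpair (boolUnpair (boolUnpair z).2).2).2 ∈
    P.stageList (boolUnpair (boolUnpair z).1).1
      (P.tabsOf (boolUnpair (boolUnpair z).1).1 (boolUnpair (boolUnpair z).1).2 (boolUnpair (boolUnpair z).2).1)
      (boolUnpair (boolUnpair (boolUnpair z).2).2).1.length}

/-- Membership in `HeavyLang` (first field `w` read as `⟨x₀, r⟩ = boolUnpair w`). [folklore] -/
theorem mem_HeavyLang_iff (w h ν u : List Bool) :
    boolPair w (boolPair h (boolPair ν u)) ∈ P.HeavyLang ↔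
      u ∈ P.stageList (boolUnpair w).1 (P.tabsOf (boolUnpair w).1 (boolUnpair w).2 h) ν.length := by
  change (boolUnpair (boolUnpair (boolUnpair (boolPair w (boolPair h (boolPair ν u)))).2).2).2 ∈
    P.stageList _ _ _ ↔ _
  simp only [boolUnpair_boolPair]

/-- The selection predicate of the inverse-CDF sampler at index `i` (numeral order of the basis
labels): `r/2^{|r|} < F(i)`, `F` the cumulative distribution of the Born law of the final state of
the run with the tables read off `h` (false beyond the last label).
[cite: AaronsonChen2017, §5.3 (p. 23, "takes a sample z by measuring |v_{T+1}⟩")] -/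
def Sel (x₀ r h : List Bool) (i : ℕ) : Prop :=
  ∃ hi : i < 2 ^ P.nq x₀, (bitsToNat r : ℝ) < 2 ^ r.length *
    cdfR ((bornPMF (AcSim.tabRun (P.tabsOf x₀ r h) (P.gates x₀) (P.v0 x₀))).map (qregEquiv (P.nq x₀))) ⟨i, hi⟩

/-- **The cumulative-distribution predicate** on instances `⟨w, ⟨h, Y⟩⟩`, `w = ⟨x₀, r⟩`: `Y` is a
basis label (`|Y| =` number of wires) with `r/2^{|r|} < Σ_{y ≤ Y} |⟨y|V|x₀,0^m⟩|²` (numeral order),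
`V` the run with the tables read off `h` — the comparisons by which the simulator inverts the
cumulative distribution of its sample. Its membership in `PSPACE` is the second computation delegated
to the `TQBF` oracle. [cite: AaronsonChen2017, §5.3 (p. 23)] -/
def CdfLang : Language Bool :=
  {z | (boolUnpair (boolUnpair z).2).2.length = P.nq (boolUnpair (boolUnpair z).1).1 ∧
    P.Sel (boolUnpair (boolUnpair z).1).1 (boolUnpair (boolUnpair z).1).2 (boolUnpair (boolUnpair z).2).1
      (bitsToNat (boolUnpair (boolUnpair z).2).2)}

/-- Membership in `CdfLang` (first field `w` read as `⟨x₀, r⟩ = boolUnpair w`). [folklore] -/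
theorem mem_CdfLang_iff (w h Y : List Bool) :
    boolPair w (boolPair h Y) ∈ P.CdfLang ↔
      Y.length = P.nq (boolUnpair w).1 ∧ P.Sel (boolUnpair w).1 (boolUnpair w).2 h (bitsToNat Y) := by
  change (boolUnpair (boolUnpair (boolPair w (boolPair h Y))).2).2.length = _ ∧ _ ↔ _
  simp only [boolUnpair_boolPair]

/-! ### The learning phase: the `s`-th queried string as a counting condition -/

/-- **A bit of a block is set iff the slot spells a string whose padded block has that bit.**
[folklore] -/
theorem block_getD_eq_true_iff (x₀ r : List Bool) (tabs : ℕ → Set (List Bool)) (n s b : ℕ) :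
    (P.block x₀ r tabs n s).getD b false = true ↔
      ∃ u, (P.stageList x₀ tabs n)[s]? = some u ∧ (padBlock (P.Wd (wl x₀ r)) u).getD b false = true := by
  unfold block
  split_ifs with hs
  · rw [List.getElem?_eq_getElem hs]
    simp
  · rw [List.getElem?_eq_none (not_lt.1 hs)]
    simp only [List.getD_eq_getElem?_getD, List.getElem?_replicate, reduceCtorEq, false_and, exists_false,
      iff_false]
    split <;> simp

/-- The number of strings queried at stage `n` (history `h`) of numeral value below that of `u`.
[folklore] -/
def cntLess (x₀ r h : List Bool) (n : ℕ) (u : List Bool) : ℕ :=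
  ((P.stageList x₀ (P.tabsOf x₀ r h) n).filter fun u' => decide (bitsToNat u' < bitsToNat u)).length

/-- **The `s`-th queried string is the queried string with exactly `s` queried strings of smaller
numeral value** (stage lists are strictly increasing). [folklore] -/
theorem stageList_getElem?_eq_some_iff (x₀ r h : List Bool) (n s : ℕ) (u : List Bool) :
    (P.stageList x₀ (P.tabsOf x₀ r h) n)[s]? = some u ↔
      u ∈ P.stageList x₀ (P.tabsOf x₀ r h) n ∧ P.cntLess x₀ r h n u = s :=
  getElem?_eq_some_iff_of_pairwise (P.pairwise_stageList x₀ _ n) s u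

/-- The relation behind the counting condition, on decoded components: the witness `Y` is a queried
string of stage `n` of smaller numeral value than `u`, padded with zeros (`Y = u' 0⋯0`, `|u'| = |u|`).
[folklore] -/
def LessRelP (x₀ r h : List Bool) (n : ℕ) (u Y : List Bool) : Prop :=
  (∀ b ∈ Y.drop u.length, b = false) ∧ bitsToNat (Y.take u.length) < bitsToNat u ∧
    Y.take u.length ∈ P.stageList x₀ (P.tabsOf x₀ r h) n

/-- **The counting relation `LessRel`** on instances `⟨⟨w, ⟨h, ⟨ν, ⟨u, τ⟩⟩⟩⟩, Y⟩` (`LessRelP` of the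
decoded components, stage `|ν|`; the last field `τ`, a threshold, is not read). [folklore] -/
def LessRel : Language Bool :=
  {z | P.LessRelP (boolUnpair (boolUnpair (boolUnpair z).1).1).1 (boolUnpair (boolUnpair (boolUnpair z).1).1).2
    (boolUnpair (boolUnpair (boolUnpair z).1).2).1 (boolUnpair (boolUnpair (boolUnpair (boolUnpair z).1).2).2).1.length
    (boolUnpair (boolUnpair (boolUnpair (boolUnpair (boolUnpair z).1).2).2).2).1 (boolUnpair z).2}

/-- Membership in `LessRel` (first field `w` read as `⟨x₀, r⟩ = boolUnpair w`). [folklore] -/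
theorem mem_LessRel_iff (w h ν u τ Y : List Bool) :
    boolPair (boolPair w (boolPair h (boolPair ν (boolPair u τ)))) Y ∈ P.LessRel ↔
      (∀ b ∈ Y.drop u.length, b = false) ∧ bitsToNat (Y.take u.length) < bitsToNat u ∧
        Y.take u.length ∈ P.stageList (boolUnpair w).1 (P.tabsOf (boolUnpair w).1 (boolUnpair w).2 h) ν.length := by
  change P.LessRelP (boolUnpair (boolUnpair (boolUnpair
    (boolPair (boolPair w (boolPair h (boolPair ν (boolPair u τ)))) Y)).1).1).1 _ _ _ _ _ ↔ _
  simp only [boolUnpair_boolPair]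
  rfl

/-- **The witness count of `LessRel` is `cntLess`** (for a queried `u` and witnesses at least as long
as `u`: padding is a bijection). [folklore] -/
theorem countWitnesses_LessRel (w h ν u τ : List Bool) {m : ℕ} (hm : u.length ≤ m)
    (hu : u ∈ P.stageList (boolUnpair w).1 (P.tabsOf (boolUnpair w).1 (boolUnpair w).2 h) ν.length) :
    countWitnesses P.LessRel m (boolPair w (boolPair h (boolPair ν (boolPair u τ)))) =
      P.cntLess (boolUnpair w).1 (boolUnpair w).2 h ν.length u := by
  classical
  set l := P.stageList (boolUnpair w).1 (P.tabsOf (boolUnpair w).1 (boolUnpair w).2 h) ν.length with hl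
  have hnd : l.Nodup := (P.pairwise_stageList _ _ ν.length).imp fun h => by
    intro he; rw [he] at h; exact lt_irrefl _ h
  have hlen : ∀ u' ∈ l, u'.length = u.length := fun u' hu' => P.length_eq_of_mem_stageList hu' hu
  unfold countWitnesses cntLess
  rw [← hl]
  -- the padding map from the filtered list to the witnesses
  let pad : List Bool → List.Vector Bool m := fun u' =>
    ⟨(u' ++ List.replicate (m - u'.length) false).take m, by
      simp only [List.length_take, List.length_append, List.length_replicate]; omega⟩
  have hpad : ∀ u' ∈ l, (pad u').toList = u' ++ List.replicate (m - u.length) false := by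
    intro u' hu'
    change ((u' ++ List.replicate (m - u'.length) false).take m) = _
    rw [hlen u' hu', List.take_of_length_le]
    simp only [List.length_append, List.length_replicate]
    have := hlen u' hu'; omega
  have key : (Finset.univ.filter fun Y : List.Vector Bool m =>
      boolPair (boolPair w (boolPair h (boolPair ν (boolPair u τ)))) Y.toList ∈ P.LessRel) =
      ((l.filter fun u' => decide (bitsToNat u' < bitsToNat u)).map pad).toFinset := by
    ext Y
    simp only [Finset.mem_filter, Finset.mem_univ, true_and, List.mem_toFinset, List.mem_map, List.mem_filter,
      decide_eq_true_eq, mem_LessRel_iff]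
    constructor
    · rintro ⟨hz, hlt, hmem⟩
      refine ⟨Y.toList.take u.length, ⟨hmem, hlt⟩, ?_⟩
      apply List.Vector.toList_injective
      rw [hpad _ hmem]
      conv_rhs => rw [← List.take_append_drop u.length Y.toList]
      congr 1
      refine List.ext_getElem ?_ fun i h₁ h₂ => ?_
      · simp only [List.length_replicate, List.length_drop, List.Vector.toList_length]
      · rw [List.getElem_replicate]
        exact (hz _ (List.getElem_mem h₂)).symm
    · rintro ⟨u', ⟨hmem, hlt⟩, rfl⟩
      have e1 : (pad u').toList.take u.length = u' := by
        rw [hpad u' hmem, List.take_append_of_le_length (by rw [hlen u' hmem]), ← hlen u' hmem, List.take_length]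
      have e2 : (pad u').toList.drop u.length = List.replicate (m - u.length) false := by
        rw [hpad u' hmem, ← hlen u' hmem, List.drop_left]
      rw [e1, e2]
      exact ⟨fun b hb => (List.eq_of_mem_replicate hb), hlt, hmem⟩
  rw [key, List.toFinset_card_of_nodup, List.length_map]
  refine (List.Nodup.filter _ hnd).map_on fun a ha b hb hab => ?_
  rw [List.mem_filter] at ha hb
  have := congrArg List.Vector.toList hab
  rw [hpad a ha.1, hpad b hb.1] at this
  exact List.append_cancel_right this

/-! ### The sampling and output phases: the sample as the least selected label -/

/-- **`Y` is the sample**: a basis label (as a bit string of the right length) that is selected and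
below which nothing is selected. [cite: KnuthTAOCP2, §3.4.1 A] -/
def IsSample (x₀ r h Y : List Bool) : Prop :=
  Y.length = P.nq x₀ ∧ P.Sel x₀ r h (bitsToNat Y) ∧
    ∀ Y' : List Bool, Y'.length = Y.length → bitsToNat Y' < bitsToNat Y → ¬ P.Sel x₀ r h (bitsToNat Y')

/-- The selector of the sampler is the least selected index. [cite: KnuthTAOCP2, §3.4.1 A] -/
theorem invCdf_isLeast {M : ℕ} [NeZero M] (p : PMF (Fin M)) {m rv : ℕ} (hr : rv < 2 ^ m) :
    (rv : ℝ) < 2 ^ m * cdfR p (invCdf p m rv) ∧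
      ∀ i : Fin M, (rv : ℝ) < 2 ^ m * cdfR p i → invCdf p m rv ≤ i := by
  have hne := filter_lt_cdfR_nonempty p hr
  have e : invCdf p m rv = (Finset.univ.filter fun i : Fin M => (rv : ℝ) < 2 ^ m * cdfR p i).min' hne := by
    rw [invCdf, dif_pos hne]
  rw [e]
  refine ⟨?_, fun i hi => Finset.min'_le _ _ (by simpa using hi)⟩
  have := Finset.min'_mem _ hne
  simpa using this

/-- The bit string of the label listed at index `i`. [folklore] -/
theorem ofFn_qregEquiv_symm (N : ℕ) (i : Fin (2 ^ N)) : List.ofFn ((qregEquiv N).symm i) = natBits N i := by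
  have h : qregFin N ((qregEquiv N).symm i) = i := (qregEquiv N).apply_symm_apply i
  have hv : bitsToNat (List.ofFn ((qregEquiv N).symm i)) = i := by
    rw [← qregFin_val, h]
  conv_lhs => rw [← CoinEnum.natBits_bitsToNat (List.ofFn ((qregEquiv N).symm i))]
  rw [List.length_ofFn, hv]

/-- **The sample is the least selected label**: `ofFn (ySample) = Y ↔ IsSample Y` (tables read off
`h`). [cite: AaronsonChen2017, §5.3 (p. 23)] [cite: KnuthTAOCP2, §3.4.1 A] -/
theorem ofFn_ySample_eq_iff (x₀ r h Y : List Bool) :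
    List.ofFn (P.ySample x₀ r (P.tabsOf x₀ r h)) = Y ↔ P.IsSample x₀ r h Y := by
  set p := (bornPMF (AcSim.tabRun (P.tabsOf x₀ r h) (P.gates x₀) (P.v0 x₀))).map (qregEquiv (P.nq x₀)) with hp
  have hr : bitsToNat r < 2 ^ r.length := bitsToNat_lt r
  obtain ⟨hsel, hmin⟩ := invCdf_isLeast p hr
  have hy : P.ySample x₀ r (P.tabsOf x₀ r h) = (qregEquiv (P.nq x₀)).symm (invCdf p r.length (bitsToNat r)) := rfl
  have hSel : ∀ (i : ℕ) (hi : i < 2 ^ P.nq x₀), P.Sel x₀ r h i ↔ (bitsToNat r : ℝ) < 2 ^ r.length * cdfR p ⟨i, hi⟩ := by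
    intro i hi
    exact ⟨fun ⟨_, h⟩ => h, fun h => ⟨hi, h⟩⟩
  constructor
  · rintro rfl
    rw [hy, ofFn_qregEquiv_symm]
    refine ⟨length_natBits _ _, ?_, fun Y' hY' hlt hsel' => ?_⟩
    · rw [bitsToNat_natBits (invCdf p r.length (bitsToNat r)).isLt, hSel _ (invCdf p r.length (bitsToNat r)).isLt]
      exact hsel
    · rw [length_natBits] at hY'
      rw [bitsToNat_natBits (invCdf p r.length (bitsToNat r)).isLt] at hlt
      obtain ⟨hi', h'⟩ := hsel'
      exact absurd (hmin ⟨bitsToNat Y', hi'⟩ h') (not_le.2 (Fin.lt_def.2 hlt))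
  · rintro ⟨hlen, ⟨hi, hs⟩, hmin'⟩
    have hle : invCdf p r.length (bitsToNat r) ≤ ⟨bitsToNat Y, hi⟩ := hmin _ hs
    have hge : (⟨bitsToNat Y, hi⟩ : Fin (2 ^ P.nq x₀)) ≤ invCdf p r.length (bitsToNat r) := by
      by_contra hlt
      rw [not_le] at hlt
      refine hmin' (natBits (P.nq x₀) (invCdf p r.length (bitsToNat r))) (by rw [length_natBits, hlen]) ?_ ?_
      · rw [bitsToNat_natBits (invCdf p r.length (bitsToNat r)).isLt]; exact Fin.lt_def.1 hlt
      · rw [bitsToNat_natBits (invCdf p r.length (bitsToNat r)).isLt, hSel _ (invCdf p r.length (bitsToNat r)).isLt]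
        exact hsel
    have heq : invCdf p r.length (bitsToNat r) = ⟨bitsToNat Y, hi⟩ := le_antisymm hle hge
    rw [hy, ofFn_qregEquiv_symm, heq]
    change natBits (P.nq x₀) (bitsToNat Y) = Y
    rw [← hlen, CoinEnum.natBits_bitsToNat]

/-! ### The advice bit, decomposed -/

/-- **The advice language, bit by bit**: on `⟨⟨x₀, r⟩, h⟩` the advice bit is set iff `|h|` is even
and, with `j = |h|/2` and the schedule `W, S, L = learnLen, Wo` of `|⟨x₀, r⟩|`: in the learning
phase (`j < L`; stage `n = j/(SW)`, slot `s = (j mod SW)/W`, position `b = j mod W`) some queried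
string `u` of stage `n` with exactly `s` smaller queried strings has bit `b` of its padded block set;
in the sampling phase (`L ≤ j < L + W`) the sample has bit `j − L` set; in the output phase the
padded output block of `post(sample)` has bit `j − L − W` set. [cite: AaronsonChen2017, §5.3 (pp. 22–23)] -/
theorem advBit_eq_true_iff (x₀ r h : List Bool) :
    P.advBit x₀ r h = true ↔ h.length % 2 = 0 ∧
      ((h.length / 2 < P.learnLen (wl x₀ r) ∧
          ∃ u, u ∈ P.stageList x₀ (P.tabsOf x₀ r h) (h.length / 2 / (P.Sm (wl x₀ r) * P.Wd (wl x₀ r))) ∧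
            P.cntLess x₀ r h (h.length / 2 / (P.Sm (wl x₀ r) * P.Wd (wl x₀ r))) u =
              h.length / 2 % (P.Sm (wl x₀ r) * P.Wd (wl x₀ r)) / P.Wd (wl x₀ r) ∧
            (padBlock (P.Wd (wl x₀ r)) u).getD (h.length / 2 % P.Wd (wl x₀ r)) false = true) ∨
        (P.learnLen (wl x₀ r) ≤ h.length / 2 ∧ h.length / 2 < P.learnLen (wl x₀ r) + P.Wd (wl x₀ r) ∧
          ∃ Y, P.IsSample x₀ r h Y ∧ Y.getD (h.length / 2 - P.learnLen (wl x₀ r)) false = true) ∨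
        (P.learnLen (wl x₀ r) + P.Wd (wl x₀ r) ≤ h.length / 2 ∧
          ∃ Y, P.IsSample x₀ r h Y ∧
            (padBlock (P.Wo (wl x₀ r)) (P.post Y)).getD (h.length / 2 - P.learnLen (wl x₀ r) - P.Wd (wl x₀ r)) false =
              true)) := by
  unfold advBit
  split_ifs with hpar
  · simp only [hpar, true_and]
    unfold advAt
    set j := h.length / 2
    by_cases h1 : j < P.learnLen (wl x₀ r)
    · rw [if_pos h1]
      have h3 : ¬ (P.learnLen (wl x₀ r) + P.Wd (wl x₀ r) ≤ j) := by omega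
      simp only [h1, true_and, not_le.2 h1, false_and, h3, or_false]
      rw [P.block_getD_eq_true_iff]
      refine exists_congr fun u => ?_
      rw [P.stageList_getElem?_eq_some_iff, and_assoc]
    · rw [if_neg h1]
      simp only [h1, false_and, false_or, not_lt.1 h1, true_and]
      by_cases h2 : j < P.learnLen (wl x₀ r) + P.Wd (wl x₀ r)
      · rw [if_pos h2]
        simp only [h2, true_and, not_le.2 h2, false_and, or_false]
        constructor
        · intro hb
          exact ⟨_, (P.ofFn_ySample_eq_iff x₀ r h _).1 rfl, hb⟩
        · rintro ⟨Y, hY, hb⟩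
          rwa [(P.ofFn_ySample_eq_iff x₀ r h Y).2 hY]
      · rw [if_neg h2]
        simp only [h2, false_and, false_or, not_lt.1 h2, true_and]
        constructor
        · intro hb
          exact ⟨_, (P.ofFn_ySample_eq_iff x₀ r h _).1 rfl, hb⟩
        · rintro ⟨Y, hY, hb⟩
          rwa [(P.ofFn_ySample_eq_iff x₀ r h Y).2 hY]
  · simp [hpar]

end AcProto

end Literature.Barriers.QuantumAdvantage

end
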